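import Literature.AlgebraicGeometry.Frobenioids.PadicFrobenioidSplitting
import Literature.AlgebraicGeometry.Frobenioids.ModelFrobenioidMap
import HarnessLib

/-!
# Frobenioids II, Remark 1.2.2: sections of `O^×(−)`, twisted characteristic splittings, `U`, `Ψ_U`

Mochizuki, *The geometry of Frobenioids II*, Kyushu J. Math. **62** (2008) 401–460, §1, Remark 1.2.2, p. 10
[cite: MochizukiFrdII2008, Rmk 1.2.2 p.10]:

> "Consider the functors `O^▷(−)`, `O^×(−)` on `D` determined by `C` [cf. [FrdI], Proposition 2.2,
> (ii), (iii)]. Let `u_D : (Ob(D) ∋) A_D ↦ u_{A_D} ∈ O^×(A_D)` be a 'section' of the functor `O^×(−)`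
> [i.e., every arrow `φ : A_D → B_D` of `D` maps `u_{B_D} ↦ u_{A_D}`]. Suppose that `Φ` is absolutely
> primitive, and that `Λ = ℤ` [so `O^▷(A_D)^char = O^▷(A_D)/O^×(A_D) ≅ ℤ_{≥0}`]. Then if `τ` is a
> characteristic splitting on `C`, then it follows immediately that `u_D` determines a new characteristic
> splitting '`u_D · τ`', by taking `(u_D · τ)(A_D) := (u_{A_D} · η)^{ℤ_{≥0}} ⊆ O^▷(A_D)` for
> `η ∈ τ(A_D) ⊆ O^▷(A_D)` a generator of `τ(A_D)`. Moreover, one obtains a unique automorphism `U` of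
> the data `(Φ, B → Φ^gp)` which is the identity on `O^×(−)` [regarded as a subfunctor of `B`] and `Φ`,
> but which maps `τ` [where we regard `O^▷(−)` as a subfunctor of `B` such that `B = O^▷(−)^gp`] to
> `u_D · τ`. Thus, `U` induces a self-equivalence `Ψ_U : C ⥲ C` of the model Frobenioid `C`. In
> particular, `Ψ_U` exhibits an example of a situation where `p ∈ ℚ_p^×` is mapped to some
> `p · u ∈ ℚ_p^×`, where `u ∈ ℤ_p^×` — a situation which, of course, never arises in conventional
> scheme theory."

This file types the PRINTED CONSTRUCTION (statements-first), as the additive repair announced for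
referee finding J5-F1 on `PadicFrobenioidThm12.Rmk122_twist` (abc-iut-L1-t4 gen 0), which is NOT a
paraphrase of Remark 1.2.2 but an OWN VARIANT (weaker hypothesis — one nontrivial unit instead of a
section —, and a conclusion — `Ψ ≇ id` — that is not printed):

* `Datum.UnitSection d` — a "section" `u_D` of `O^×(−)` on `D`: a family `u_A ∈ Ker(Div_B) ⊆ B(A_D)`
  (`= O^×(A)` for every object `A` of `C` over `A_D`, [FrdI] Thm. 5.2 (ii) / abc-iut-L1-d10's
  `PadicFrobenioidUnitGroups`) compatible with all pull-backs `B(f)`; its unit endomorphisms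
  `w_X = (1, id, 0, u_{A_D})` (`UnitSection.unitEnd`, in `O^▷(X)`, PROVED);
* `IsGeneratorOf η S` ("`η` a generator of `τ(A_D)`"), `UnitSection.twist` — `u_D · τ`, the family of
  submonoids generated by `η · w_X` for `η` a generator of `τ(X)`;
* `Rmk122TwistOfBijective` — sentence 3 under the READING (R1) "every pull-back map `Φ(f)`,
  `f ∈ Arr(D)`, is bijective" (statement).  **FINDING T4g2-F1 (abc-iut-L1-t4 gen 2, INBOX
  2026-08-25, LOW, neutral):** as printed — for an arbitrary absolutely primitive `p`-adic Frobenioid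
  datum — sentence 3 fails under our reading of [FrdI] Def. 2.3 (subfunctoriality on linear morphisms)
  as soon as the generator of `Φ(A_D) ≅ ℤ_{≥0}` inside `Φ₀(A_D)` changes degree along a (non-FSM) arrow
  of `D` (hand witness: `D = B(ℤ/2ℤ)⁰`, base constant `Spec ℚ_p`, `Φ(pt) = 2 · ord(p) · ℤ_{≥0} ⊆ Φ(G) =
  ord(p) · ℤ_{≥0}`, `τ = τ_p`, `u_D ≡ 1 + p`: the pull-back of `η_{pt} · u` along the linear arrow over
  `G → pt` has rational function `(1+p)p²`, which is not a power of `(1+p)p`); it holds when the pull-backs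
  of `Φ` are bijective (e.g. the "constant" submonoids `Φ_{C_v}`, `Φ_{C_v^⊢}` of [IUTchI] Ex. 3.2–3.3).
  By RULING P1 of the cell the hypothesis-free sentence is therefore not typed as a bare named statement;
* `UnitSection.upSplittingSubmonoid`, `Rmk122R2` — reading (R2): the hypothesis-free twisted splitting
  `τ_{u·p}` (rational function a power of `u·p`), a characteristic splitting for every absolutely primitive
  datum (statement; OWN repaired reading);
* `Rmk122UOfBijective` — sentence 4 under (R1): a unique automorphism `U = (id_Φ, β)` of the data
  (`ModelFrobenioid.DataHom d.divB d.divB`, abc-iut-L1-t5) fixing `Ker(Div_B) = O^×(−)` pointwise and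
  sending the rational function of a generator `η` of `τ(X)` to `u_η · u_{A_D}` (statement);
* `Rmk122SelfEquivalence` — sentence 5: every automorphism `(id_Φ, β)` of the data with `β` objectwise
  bijective induces a self-equivalence `Ψ_U := U.functor : C ⥲ C` (statement, general);
  "`p ↦ p · u`" is the defining property of `U` at `η =` the generator of `τ_p` with `u_η|_{K^×} = p`.

Nothing here is asserted; typed ≠ proved. No statement of the paper is strengthened: (R1) is weaker than
print only by making the tacit constancy of `Φ` explicit.
-/

noncomputable section

namespace Literature.AlgebraicGeometry.Frobenioids

namespace PadicFrd

open CategoryTheory Opposite Function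

universe v u

namespace Datum

variable {D : Type u} [Category.{v} D] {p : ℕ} [Fact p.Prime] (d : Datum D p)

/-! ### Sections of `O^×(−)` -/

/-- A "section" `u_D : A_D ↦ u_{A_D} ∈ O^×(A_D)` of the functor `O^×(−)` on `D` determined by `C`
("every arrow `φ : A_D → B_D` of `D` maps `u_{B_D} ↦ u_{A_D}`", FrdII Rmk. 1.2.2), with `O^×(A_D)` rendered
as `Ker(Div_B : B(A_D) → Φ^gp(A_D))` — which IS `O^×(A)` for every object `A` of the model Frobenioid over
`A_D` ([FrdI] Thm. 5.2 (ii); `ModelFrobenioid.units`, abc-iut-L1-d10's `PadicFrobenioidUnitGroups`).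
[cite: MochizukiFrdII2008, Rmk 1.2.2 p.10] -/
structure UnitSection : Type u where
  /-- `u_{A_D} ∈ B(A_D)` -/
  u : ∀ A : D, d.B.obj (op A)
  /-- `u_{A_D} ∈ O^×(A_D) = Ker(Div_B)` -/
  divB_u : ∀ A : D, Frobenioids.divB d.Φ d.B d.divB (op A) (u A) = 1
  /-- compatibility: `B(f)(u_{A'}) = u_A` for every `f : A → A'` -/
  map_u : ∀ {A A' : D} (f : A ⟶ A'), (d.B.map f.op).hom (u A') = u A

namespace UnitSection

variable {d} (s : d.UnitSection)

/-- The unit endomorphism `w_X := (1, id, 0, u_{A_D}) ∈ O^×(X) ⊆ O^▷(X)` of an object `X` over `A_D`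
determined by the section ("`O^×(−)` regarded as a subfunctor of `B`", FrdII Rmk. 1.2.2).
[cite: MochizukiFrdII2008, Rmk 1.2.2 p.10] -/
def unitEnd (X : d.frobenioid) : X ⟶ X :=
  ModelFrobenioid.unitEnd X 1 (s.u X.base) (by rw [map_one, s.divB_u])

/-- `w_X ∈ O^▷(X)`. [cite: MochizukiFrdII2008, Rmk 1.2.2 p.10] -/
theorem unitEnd_mem (X : d.frobenioid) :
    s.unitEnd X ∈ PreFrobenioid.endSubmonoid d.structureFunctor X :=
  d.unitEnd_mem_endSubmonoid X _ _ _

/-- The rational function of `w_X` is `u_{A_D}`. [cite: MochizukiFrdII2008, Rmk 1.2.2 p.10] -/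
@[simp] theorem unit_unitEnd (X : d.frobenioid) : ModelFrobenioid.unit (s.unitEnd X) = s.u X.base := rfl

/-- `u_{A_D}|_{K^×}` is a unit of the valuation ring `O_{K_{A_D}}` (`Div₀(u|_{K^×}) = ι^gp(Div_B u) = 0`
and `Ker(Div₀) = O_K^×`, abc-iut-L1-d10). [cite: MochizukiFrdII2008, Rmk 1.2.2 p.10] -/
theorem resK_u_mem_unitSubgroup (A : D) : d.resK A (s.u A) ∈ unitSubgroup (d.fld A) := by
  obtain ⟨⟨inst, hfin, hc⟩⟩ := d.isPadicLocal A
  letI := inst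
  haveI := hfin
  rw [← ker_divZeroHom_eq_unitSubgroup hc, MonoidHom.mem_ker, d.divZeroHom_resK, s.divB_u, map_one]

/-- The restriction maps fix the section: `σ_f(u_{A'}|_{K^×}) = u_A|_{K^×}`. [cite: MochizukiFrdII2008, Rmk 1.2.2 p.10] -/
theorem units_map_resK_u {A A' : D} (f : A ⟶ A') :
    Units.map ((d.base.map f).alg : d.fld A' →* d.fld A) (d.resK A' (s.u A')) = d.resK A (s.u A) := by
  rw [← d.resK_mapB, s.map_u]

end UnitSection

/-! ### Twisted splittings `u_D · τ` -/

/-- "`η` a generator of `τ(A_D)`" (a cyclic submonoid `τ(A_D) ≅ ℤ_{≥0}`): `η ∈ S` and every element of `S`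
is a power of `η`. [cite: MochizukiFrdII2008, Rmk 1.2.2 p.10] -/
def IsGeneratorOf {M : Type*} [Monoid M] (η : M) (S : Submonoid M) : Prop :=
  η ∈ S ∧ ∀ s ∈ S, ∃ k : ℕ, s = η ^ k

namespace UnitSection

variable {d} (s : d.UnitSection)

/-- **`u_D · τ`**: "`(u_D · τ)(A_D) := (u_{A_D} · η)^{ℤ_{≥0}} ⊆ O^▷(A_D)` for `η` a generator of `τ(A_D)`"
— for a family `τ` of submonoids of the `End X` (the shape of abc-iut-L1-t2's `CharacteristicSplitting.τ`),
the submonoid generated by the `η · w_X`, `η` a generator of `τ(X)`. [cite: MochizukiFrdII2008, Rmk 1.2.2 p.10] -/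
def twist (τ : ∀ X : d.frobenioid, Submonoid (End X)) (X : d.frobenioid) : Submonoid (End X) :=
  Submonoid.closure {e | ∃ η : End X, IsGeneratorOf η (τ X) ∧ e = η * End.of (s.unitEnd X)}

/-- `η · w_X ∈ (u_D · τ)(X)` for every generator `η` of `τ(X)`. [cite: MochizukiFrdII2008, Rmk 1.2.2 p.10] -/
theorem mul_unitEnd_mem_twist (τ : ∀ X : d.frobenioid, Submonoid (End X)) {X : d.frobenioid} {η : End X}
    (hη : IsGeneratorOf η (τ X)) : η * End.of (s.unitEnd X) ∈ s.twist τ X :=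
  Submonoid.subset_closure ⟨η, hη, rfl⟩

end UnitSection

/-- **Reading (R2) — the hypothesis-free twisted splitting `τ_{u·p}`** (FINDING T4g2-F1): for a section
`u_D` of `O^×(−)`, `τ_{u·p}(X) ⊆ O^▷(X)` is the submonoid of base-identity linear endomorphisms whose rational
function restricted to `K_{A_D}^×` is a power of `u_{A_D}|_{K^×} · p`.  It coincides with print's `u_D · τ_p`
when `Φ(A_D) ∋ ord(p)` for all `A_D` (generators of degree one) and is a characteristic splitting for EVERY
absolutely primitive datum (statement `Rmk122R2` below; same proof as for `τ_p`, since the restriction maps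
fix `u · p` and `v(u · p) = v(p)`). OWN repaired reading, not the printed sentence.
[cite: MochizukiFrdII2008, Rmk 1.2.2 p.10] -/
def UnitSection.upSplittingSubmonoid (s : d.UnitSection) (X : d.frobenioid) : Submonoid (End X) where
  carrier := {e | e ∈ PreFrobenioid.endSubmonoid d.structureFunctor X ∧
    ∃ m : ℕ, d.resK X.base (ModelFrobenioid.unit (End.asHom e)) = (d.resK X.base (s.u X.base) * d.primeUnit X.base) ^ m}
  one_mem' := ⟨Submonoid.one_mem _, 0, by
    rw [pow_zero]
    change d.resK X.base (ModelFrobenioid.unit (𝟙 X)) = 1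
    rw [ModelFrobenioid.unit_id, map_one]⟩
  mul_mem' := by
    rintro a b ⟨ha, m, hm⟩ ⟨hb, m', hm'⟩
    refine ⟨Submonoid.mul_mem _ ha hb, m + m', ?_⟩
    change d.resK X.base (ModelFrobenioid.unit (End.asHom b ≫ End.asHom a)) = _
    rw [d.unit_comp_of_mem (e := End.asHom a) (e' := End.asHom b) ha hb, map_mul, hm, hm', pow_add]

/-- **Reading (R2)** (statement): for every absolutely primitive datum and every section `u_D` of `O^×(−)`,
`τ_{u·p}` (`UnitSection.upSplittingSubmonoid`) is a characteristic splitting on `C` ([FrdI] Def. 2.3 as typed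
by abc-iut-L1-t2) — the hypothesis-free repair of Remark 1.2.2, sentence 3, for `τ = τ_p` (OWN reading; the
proof is that of `Datum.pSplitting` with `p` replaced by `u · p`). [cite: MochizukiFrdII2008, Rmk 1.2.2 p.10] -/
def Rmk122R2 : Prop :=
  d.IsAbsolutelyPrimitive → ∀ s : d.UnitSection,
    ∃ T : PreFrobenioid.CharacteristicSplitting d.structureFunctor, T.τ = s.upSplittingSubmonoid

/-! ### Remark 1.2.2, sentences 3–5 (statements) -/

/-- The constancy hypothesis made explicit by reading (R1): every pull-back map of `Φ` is bijective
(then generators of `Φ(A_D) ≅ ℤ_{≥0}` pull back to generators). Holds e.g. for the "constant" submonoids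
of [IUTchI] Ex. 3.2–3.3. [cite: MochizukiFrdII2008, Rmk 1.2.2 p.10] -/
def HasBijectivePullbacks : Prop := ∀ {A A' : D} (f : A ⟶ A'), Bijective (d.Φ.map f.op).hom

/-- **Remark 1.2.2, sentence 3, reading (R1)** (statement): if every pull-back map of `Φ` is bijective,
`Φ` is absolutely primitive (and `Λ = ℤ`, as throughout `PadicFrobenioid.lean`), then for every section
`u_D` of `O^×(−)` and every characteristic splitting `τ` on `C`, `u_D · τ` is again a characteristic
splitting on `C` ([FrdI] Def. 2.3 as typed by abc-iut-L1-t2). The printed sentence has no bijectivity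
hypothesis; without it the claim fails under our reading (FINDING T4g2-F1, see the module docstring), so
by RULING P1 only this reading is typed. [cite: MochizukiFrdII2008, Rmk 1.2.2 p.10] -/
def Rmk122TwistOfBijective : Prop :=
  d.HasBijectivePullbacks → d.IsAbsolutelyPrimitive →
    ∀ (s : d.UnitSection) (T : PreFrobenioid.CharacteristicSplitting d.structureFunctor),
      ∃ T' : PreFrobenioid.CharacteristicSplitting d.structureFunctor, T'.τ = s.twist T.τ

/-- An automorphism `U` of the data `(Φ, B → Φ^gp)` "which is the identity on `Φ`": a morphism of model
data `(Φ, B, Div_B) → (Φ, B, Div_B)` (abc-iut-L1-t5's `ModelFrobenioid.DataHom`) with `η = id_Φ` and `β`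
objectwise bijective. [cite: MochizukiFrdII2008, Rmk 1.2.2 p.10] -/
structure IsDataAutomorphism (U : ModelFrobenioid.DataHom d.divB d.divB) : Prop where
  /-- `U` is the identity on `Φ` -/
  η_eq : U.η = 𝟙 d.Φ
  /-- `β_A : B(A) → B(A)` is bijective for every `A` -/
  bijective : ∀ A : Dᵒᵖ, Bijective (U.β.app A).hom

/-- `U` "is the identity on `O^×(−)` [regarded as a subfunctor of `B`]": `β` fixes `Ker(Div_B)` pointwise.
[cite: MochizukiFrdII2008, Rmk 1.2.2 p.10] -/
def FixesUnits (U : ModelFrobenioid.DataHom d.divB d.divB) : Prop :=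
  ∀ (A : Dᵒᵖ) (b : d.B.obj A), Frobenioids.divB d.Φ d.B d.divB A b = 1 → (U.β.app A).hom b = b

/-- `U` "maps `τ` to `u_D · τ`" [regarding `O^▷(−)` as a subfunctor of `B`, `B = O^▷(−)^gp`]: `β` sends the
rational function of a generator `η` of `τ(X)` to that of `η · w_X`, i.e. to `u_η · u_{A_D}`.
[cite: MochizukiFrdII2008, Rmk 1.2.2 p.10] -/
def MapsSplittingTo (U : ModelFrobenioid.DataHom d.divB d.divB) (s : d.UnitSection)
    (τ : ∀ X : d.frobenioid, Submonoid (End X)) : Prop :=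
  ∀ (X : d.frobenioid) (η : End X), IsGeneratorOf η (τ X) →
    (U.β.app (op X.base)).hom (ModelFrobenioid.unit (End.asHom η)) =
      ModelFrobenioid.unit (End.asHom η) * s.u X.base

/-- **Remark 1.2.2, sentence 4, reading (R1)** (statement): under the hypotheses of sentence 3 "one
obtains a unique automorphism `U` of the data `(Φ, B → Φ^gp)` which is the identity on `O^×(−)` … and
`Φ`, but which maps `τ` … to `u_D · τ`." [cite: MochizukiFrdII2008, Rmk 1.2.2 p.10] -/
def Rmk122UOfBijective : Prop :=
  d.HasBijectivePullbacks → d.IsAbsolutelyPrimitive →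
    ∀ (s : d.UnitSection) (T : PreFrobenioid.CharacteristicSplitting d.structureFunctor),
      ∃! U : ModelFrobenioid.DataHom d.divB d.divB,
        d.IsDataAutomorphism U ∧ d.FixesUnits U ∧ d.MapsSplittingTo U s T.τ

/-- **Remark 1.2.2, sentence 5** (statement, general form): an automorphism `U` of the data which is the
identity on `Φ` "induces a self-equivalence `Ψ_U : C ⥲ C` of the model Frobenioid `C`" — the induced
functor `U.functor` (abc-iut-L1-t5's `ModelFrobenioid.DataHom.functor`, [FrdI] Prop. 5.3) is an
equivalence. [cite: MochizukiFrdII2008, Rmk 1.2.2 p.10] -/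
def Rmk122SelfEquivalence : Prop :=
  ∀ U : ModelFrobenioid.DataHom d.divB d.divB, d.IsDataAutomorphism U → U.functor.IsEquivalence

/-- **Remark 1.2.2, sentence 5 — PROVED in general**: an automorphism `U = (id_Φ, β)` of the data with
`β` objectwise bijective induces an equivalence `Ψ_U = U.functor : C ⥲ C` (it is faithful and full — a
morphism `(d, f, Div, u)` between the image objects has the unique preimage `(d, f, Div, β⁻¹(u))`, the
relation (d) being transported by `Div_B ∘ β = Div_B` — and essentially surjective, indeed bijective on
objects since `id_Φ^gp = id`). [cite: MochizukiFrdII2008, Rmk 1.2.2 p.10] -/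
theorem rmk122SelfEquivalence_holds : d.Rmk122SelfEquivalence := by
  intro U hU
  have hη : U.η = 𝟙 d.Φ := hU.η_eq
  have hηz : ∀ (A : Dᵒᵖ) (z : d.Φ.obj A), (U.η.app A).hom z = z := fun A z => by rw [hη]; rfl
  have hg : ∀ (A : Dᵒᵖ) (c : Algebra.GrothendieckGroup (d.Φ.obj A)), gpApp U.η A c = c := fun A c => by
    change MonGp.map (U.η.app A).hom c = c
    rw [hη]
    change MonGp.map (MonoidHom.id _) c = c
    rw [MonGp.map_id]
    rfl
  have hdivβ : ∀ (A : Dᵒᵖ) (u : d.B.obj A),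
      Frobenioids.divB d.Φ d.B d.divB A ((U.β.app A).hom u) = Frobenioids.divB d.Φ d.B d.divB A u :=
    fun A u => by rw [← U.comm A u, hg]
  haveI : U.functor.Faithful := ⟨fun {X Y} φ ψ h => by
    have h1 := congrArg ModelFrobenioid.degFr h
    have h2 := congrArg ModelFrobenioid.baseMap h
    have h3 := congrArg ModelFrobenioid.div h
    have h4 := congrArg ModelFrobenioid.unit h
    refine ModelFrobenioid.hom_ext h1 h2 ?_ ((hU.bijective (op X.base)).1 h4)
    have h3' : (U.η.app (op X.base)).hom (ModelFrobenioid.div φ) =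
        (U.η.app (op X.base)).hom (ModelFrobenioid.div ψ) := h3
    rwa [hηz, hηz] at h3'⟩
  haveI : U.functor.Full := ⟨fun {X Y} g => by
    -- the components of `g : Ψ_U(X) → Ψ_U(Y)`, read over `X`, `Y` (same base objects)
    let dg : ℕ+ := ModelFrobenioid.degFr (X := U.functor.obj X) (Y := U.functor.obj Y) g
    let fg : X.base ⟶ Y.base := ModelFrobenioid.baseMap (X := U.functor.obj X) (Y := U.functor.obj Y) g
    let zg : d.Φ.obj (op X.base) := ModelFrobenioid.div (X := U.functor.obj X) (Y := U.functor.obj Y) g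
    let ug : d.B.obj (op X.base) := ModelFrobenioid.unit (X := U.functor.obj X) (Y := U.functor.obj Y) g
    obtain ⟨u, hu⟩ := (hU.bijective (op X.base)).2 ug
    have hr : X.cls ^ (dg : ℕ) * Algebra.GrothendieckGroup.of zg =
        pullGp d.Φ fg Y.cls * Frobenioids.divB d.Φ d.B d.divB (op X.base) u := by
      have hr0 := ModelFrobenioid.rel (X := U.functor.obj X) (Y := U.functor.obj Y) g
      change gpApp U.η (op X.base) X.cls ^ (dg : ℕ) * Algebra.GrothendieckGroup.of zg =
        pullGp d.Φ fg (gpApp U.η (op Y.base) Y.cls) * Frobenioids.divB d.Φ d.B d.divB (op X.base) ug at hr0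
      rw [hg, hg, ← hu, hdivβ] at hr0
      exact hr0
    refine ⟨⟨dg, fg, zg, u, hr⟩, ModelFrobenioid.hom_ext rfl rfl ?_ ?_⟩
    · exact hηz (op X.base) zg
    · exact hu⟩
  haveI : U.functor.EssSurj := ⟨fun Y => ⟨Y, ⟨eqToIso (by
    obtain ⟨b, c⟩ := Y
    change (⟨b, gpApp U.η (op b) c⟩ : d.frobenioid) = ⟨b, c⟩
    rw [hg])⟩⟩⟩
  exact ⟨inferInstance, inferInstance, inferInstance⟩

/-- **Remark 1.2.2, last sentence** ("`Ψ_U` exhibits an example of a situation where `p ∈ ℚ_p^×` is mapped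
to some `p · u ∈ ℚ_p^×`, where `u ∈ ℤ_p^×`"): for `U` mapping the splitting `τ_p` of Thm. 1.2 (v) to
`u_D · τ_p` and `η` a generator of `τ_p(X)` whose rational function restricted to `K^×` is `p` (the case
`Φ(A_D) ∋ ord(p)`), the rational function of `β(u_η)` restricted to `K^×` is `p · u_{A_D}|_{K^×}`, a unit
multiple of `p` — immediate from `MapsSplittingTo`. [cite: MochizukiFrdII2008, Rmk 1.2.2 p.10] -/
theorem resK_β_unit_eq_p_mul (U : ModelFrobenioid.DataHom d.divB d.divB) (s : d.UnitSection)
    (hU : d.MapsSplittingTo U s d.pSplittingSubmonoid) {X : d.frobenioid} {η : End X}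
    (hη : IsGeneratorOf η (d.pSplittingSubmonoid X))
    (hp : d.resK X.base (ModelFrobenioid.unit (End.asHom η)) = d.primeUnit X.base) :
    d.resK X.base ((U.β.app (op X.base)).hom (ModelFrobenioid.unit (End.asHom η))) =
      d.primeUnit X.base * d.resK X.base (s.u X.base) ∧
        d.resK X.base (s.u X.base) ∈ unitSubgroup (d.fld X.base) := by
  refine ⟨?_, s.resK_u_mem_unitSubgroup X.base⟩
  rw [hU X η hη, map_mul, hp]

end Datum

end PadicFrd

end Literature.AlgebraicGeometry.Frobenioids
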